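import Summits.BirchSwinnertonDyer.BirchSwinnertonDyer.Theorems.UniversalToricDescentK2BetaOfSpecializedIndex
import Summits.BirchSwinnertonDyer.BirchSwinnertonDyer.Theorems.PrintX9MuPartStabilizedOfSpecWitnesses
import HarnessLib

/-!
# Route UniversalToricDescent — K2_struct∣β (`stub_selmerDualRankLeOneMuZeroOfBeta`, line `beta-road` v8 on crux `TwinAlgMuZeroAtThree`,
# stmt-BirchSwinnertonDyer-24737) FROM THE SPECIALISED OUTPUTS at Howard's Eisenstein primes `q_m = T^m + p`:
# «`rank_{ℤ_p} X/q_m X ≤ m + C` for infinitely many `m`» ∧ «`#(X_tors ⧸ q_m) ≤ p^{C′}·#((𝔖/Λκ₁) ⧸ q_m)²` for all large `m`» ∧ «`loc κ₁ ∉ pΛ`»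
# ⟹ `Module.rank Λ X ≤ 1 ∧ μ(X_tors) = 0` (any prime `p`; brick E5 + E6 glue of the lead's `STUB-BRIEF-K2beta-v7/v8`, in v8 currency)

Width prover `bsd-wall-utd-p1-w2` g11 under lead `bsd-wall-utd-p1` g23 (`--supports stmt-BirchSwinnertonDyer-24737`, helper). THEOREMS ONLY (no
definition, no named fact, no `sorry`); no `Theses` import. BSD is not proved by any of this; 24737 stays OPEN. HONEST FRAMING: `hrank` and `hKS`
are ARITHMETIC hypotheses — what Howard 2004 Thm. 1.6.1 (i)–(iii) over the DVRs `S_m = Λ/q_m` for the Tate-line Selmer structure (E2/E4), the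
Kolyvagin system from the K1 Heegner family (E1) and the control terms at `v ∣ 3` along `q_m` (E3) deliver; NOT in print at `3 ∥ N′`; not claimed here.

* §1 (pure `Λ`-algebra, any `p`) `rank_le_one_and_muInvariant_torsion_eq_zero_of_specialized`: `X` finitely generated; `hrank`; `𝔖` finitely
  generated torsion-free of `Λ`-rank one, `κ₁ ∈ 𝔖`, `loc : 𝔖 →ₗ Λ`, `loc κ₁ ∉ pΛ`; `hKS` ⟹ `Module.rank Λ X ≤ 1 ∧ μ(X_tors) = 0`
  (p748126 `…EisensteinSpecializationRank.finrank_le_one_of_lambdaInvariant_quotient_X_pow_add_C_le` + `Module.finrank_eq_rank`;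
  p748447 `…K2BetaOfSpecializedIndex.muInvariant_torsion_eq_zero_of_card_quotSMulTop_qm_le_of_not_mem`); and the `μ(N′) = 0` form.
* §2 (`p = 3`) `selmerDualRankLeOneMuZero_of_specialized`: the CONCLUSION of the v8 stub `stub_selmerDualRankLeOneMuZeroOfBeta` VERBATIM —
  `Module.rank Λ ((W′.baseChange K).selmerDualData κ hγ.out).X ≤ 1 ∧ muInvariant 3 ↥(torsion Λ (…).X) = 0` — from `hrank ∧ hKS ∧ loc κ₁ ∉ 3Λ`
  for THAT dual datum (and `…_of_specialized'` for any dual datum `D`).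
* §3 (the x9 WITNESS currency) `rank_le_one_and_muInvariant_torsion_eq_zero_of_hasSpecWitnesses` /
  `selmerDualRankLeOneMuZero_of_hasSpecWitnesses`: `hKS` replaced by cell `bsd-print-x9`'s **`HasSpecWitnesses p 𝔖 X (Λ∙κ₁)`**
  (`PrintX9MuPartSpecWitnessDefs`: for all large `m` a `SpecWitness` at `q_m` — compact control `𝔖 → H`, discrete control `X/q_m X → Xq`,
  error-free DVR bound `#Xq_tors ≤ #(H/Λκ₁)²` — whose constructors from Howard's Thm. 1.6.1 CONCLUSION on a `DVRSetting` over `S_m` are the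
  x9/x10b turnkeys `nonempty_specWitness_of_dvrConclusion[_of_readout]`), through `HeegnerMuPartStabilized.exists_card_bound_of_specWitnesses`.
  So the v8 stub follows from: `hrank` ∧ `HasSpecWitnesses 3 𝔖 X(E′/K_∞) (Λ∙κ₁)` ∧ `loc κ₁ ∉ 3Λ`.

References: [Howard2004HeegnerKolyvagin] Thm. 1.6.1, Thm. B, proof of Thm. 2.2.10 (arXiv:1202.6340 p. 18); [MazurRubin2004] §5.3; [Washington1997] §13.2.
-/

set_option linter.dupNamespace false
set_option autoImplicit false

noncomputable section

open scoped Classical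

namespace Summit.BirchSwinnertonDyer.BirchSwinnertonDyer.Theorems.UniversalToricDescentK2StructOfSpecialized

open Literature.NumberTheory.EllipticCurves Literature.NumberTheory.EllipticCurves.IwasawaAlgebra
  Summit.BirchSwinnertonDyer.BirchSwinnertonDyer.Theorems.UniversalToricDescentEisensteinSpecializationRank
  Summit.BirchSwinnertonDyer.BirchSwinnertonDyer.Theorems.UniversalToricDescentK2BetaOfSpecializedIndex

/-! ## §1 Pure algebra: `hrank ∧ hKS ∧ (loc κ₁ ∉ pΛ | μ(N′) = 0) ⟹ rank ≤ 1 ∧ μ(X_tors) = 0` -/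

section Lambda

variable {p : ℕ} [Fact p.Prime]
variable {M : Type*} [AddCommGroup M] [Module (IwasawaAlgebra p) M]

/-- `finrank ≤ 1 ⟹ Module.rank ≤ 1` for a finitely generated `Λ`-module (`Λ` is a commutative ring, so `rank = finrank < ℵ₀`). [folklore] -/
theorem rank_le_one_of_finrank_le_one [Module.Finite (IwasawaAlgebra p) M]
    (h1 : Module.finrank (IwasawaAlgebra p) M ≤ 1) : Module.rank (IwasawaAlgebra p) M ≤ 1 := by
  rw [← Module.finrank_eq_rank (IwasawaAlgebra p) M]
  exact_mod_cast h1

/-- **Specialised outputs ⟹ `rank ≤ 1 ∧ μ(X_tors) = 0` (the `μ(N′) = 0` form).** `X` finitely generated over `Λ = ℤ_p⟦T⟧`; `hrank`: `rank_{ℤ_p} X/q_m X ≤ m + C`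
for infinitely many `m`; `N′` finitely generated torsion with `μ(N′) = 0`; `hKS`: `#(X_tors ⧸ q_m X_tors) ≤ p^{C′} · #(N′ ⧸ q_m N′)²` for all large `m`.
[cite: Howard2004HeegnerKolyvagin, Thm. 1.6.1, proof of Thm. 2.2.10] [cite: Washington1997, §13.2] -/
theorem rank_le_one_and_muInvariant_torsion_eq_zero_of_specialized_of_mu [Module.Finite (IwasawaAlgebra p) M] (C : ℕ)
    (hrank : ∀ m₀ : ℕ, ∃ m : ℕ, m₀ ≤ m ∧
      lambdaInvariant p (M ⧸ (Ideal.span {(PowerSeries.X ^ m + PowerSeries.C (p : ℤ_[p]) : IwasawaAlgebra p)} •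
        (⊤ : Submodule (IwasawaAlgebra p) M))) ≤ m + C)
    {N' : Type*} [AddCommGroup N'] [Module (IwasawaAlgebra p) N'] [Module.Finite (IwasawaAlgebra p) N']
    (hN' : Module.IsTorsion (IwasawaAlgebra p) N') (hμ' : muInvariant p N' = 0)
    (hKS : ∃ C m₀ : ℕ, ∀ m : ℕ, m₀ ≤ m →
      Nat.card (↥(Submodule.torsion (IwasawaAlgebra p) M) ⧸
        (Ideal.span {(PowerSeries.X ^ m + PowerSeries.C (p : ℤ_[p]) : IwasawaAlgebra p)} • ⊤ :
          Submodule (IwasawaAlgebra p) ↥(Submodule.torsion (IwasawaAlgebra p) M))) ≤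
      p ^ C * Nat.card (N' ⧸ (Ideal.span {(PowerSeries.X ^ m + PowerSeries.C (p : ℤ_[p]) : IwasawaAlgebra p)} • ⊤ :
          Submodule (IwasawaAlgebra p) N')) ^ 2) :
    Module.rank (IwasawaAlgebra p) M ≤ 1 ∧ muInvariant p ↥(Submodule.torsion (IwasawaAlgebra p) M) = 0 :=
  ⟨rank_le_one_of_finrank_le_one (finrank_le_one_of_lambdaInvariant_quotient_X_pow_add_C_le (p := p) C hrank),
    muInvariant_torsion_eq_zero_of_card_quotSMulTop_qm_le hN' hμ' hKS⟩

/-- **Specialised outputs ⟹ `rank ≤ 1 ∧ μ(X_tors) = 0` (the E6 form).** `X` finitely generated over `Λ`; `hrank`: `rank_{ℤ_p} X/q_m X ≤ m + C` for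
infinitely many `m`; `𝔖` finitely generated torsion-free of `Λ`-rank one, `κ₁ ∈ 𝔖`, `loc : 𝔖 →ₗ Λ` with `loc κ₁ ∉ pΛ` (K1's `μ`-shadow); `hKS`:
`#(X_tors ⧸ q_m X_tors) ≤ p^{C′} · #((𝔖/Λκ₁) ⧸ q_m)²` for all large `m`. Then `Module.rank Λ X ≤ 1 ∧ μ(X_tors) = 0`.
[cite: Howard2004HeegnerKolyvagin, Thm. 1.6.1, Thm. B, proof of Thm. 2.2.10] [cite: Castella2017HeegnerBeilinsonFlach, App. A (A.4)] -/
theorem rank_le_one_and_muInvariant_torsion_eq_zero_of_specialized [Module.Finite (IwasawaAlgebra p) M] (C : ℕ)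
    (hrank : ∀ m₀ : ℕ, ∃ m : ℕ, m₀ ≤ m ∧
      lambdaInvariant p (M ⧸ (Ideal.span {(PowerSeries.X ^ m + PowerSeries.C (p : ℤ_[p]) : IwasawaAlgebra p)} •
        (⊤ : Submodule (IwasawaAlgebra p) M))) ≤ m + C)
    {S : Type*} [AddCommGroup S] [Module (IwasawaAlgebra p) S] [Module.Finite (IwasawaAlgebra p) S]
    [NoZeroSMulDivisors (IwasawaAlgebra p) S]
    (hS1 : Module.finrank (IwasawaAlgebra p) S = 1) (κ₁ : S)
    (loc : S →ₗ[IwasawaAlgebra p] IwasawaAlgebra p) (hβ : loc κ₁ ∉ augIdealP p)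
    (hKS : ∃ C m₀ : ℕ, ∀ m : ℕ, m₀ ≤ m →
      Nat.card (↥(Submodule.torsion (IwasawaAlgebra p) M) ⧸
        (Ideal.span {(PowerSeries.X ^ m + PowerSeries.C (p : ℤ_[p]) : IwasawaAlgebra p)} • ⊤ :
          Submodule (IwasawaAlgebra p) ↥(Submodule.torsion (IwasawaAlgebra p) M))) ≤
      p ^ C * Nat.card ((S ⧸ Submodule.span (IwasawaAlgebra p) {κ₁}) ⧸
        (Ideal.span {(PowerSeries.X ^ m + PowerSeries.C (p : ℤ_[p]) : IwasawaAlgebra p)} • ⊤ :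
          Submodule (IwasawaAlgebra p) (S ⧸ Submodule.span (IwasawaAlgebra p) {κ₁}))) ^ 2) :
    Module.rank (IwasawaAlgebra p) M ≤ 1 ∧ muInvariant p ↥(Submodule.torsion (IwasawaAlgebra p) M) = 0 :=
  ⟨rank_le_one_of_finrank_le_one (finrank_le_one_of_lambdaInvariant_quotient_X_pow_add_C_le (p := p) C hrank),
    muInvariant_torsion_eq_zero_of_card_quotSMulTop_qm_le_of_not_mem hS1 κ₁ loc hβ hKS⟩

end Lambda

/-! ## §2 The conclusion of K2_struct∣β (`stub_selmerDualRankLeOneMuZeroOfBeta`) VERBATIM at `p = 3` -/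

section K2Struct

open WeierstrassCurve

/-- **K2_struct∣β's conclusion, for ANY dual datum, from the specialised outputs.** `E′ = W′/ℚ` elliptic, `K` a number field, `κ` a `ℤ₃`-extension
with topological generator `γ`, `D` any Pontryagin-dual datum of `Sel_{3^∞}(E′_K/K_∞)` (`X = D.X` finitely generated); `hrank`, `𝔖 ∋ κ₁`, `loc`,
`loc κ₁ ∉ 3Λ`, `hKS` as in §1 (`q_m = T^m + 3`). Then `Module.rank Λ X ≤ 1 ∧ μ(X_tors) = 0`. [cite: Howard2004HeegnerKolyvagin, Thm. B] -/
theorem selmerDualRankLeOneMuZero_of_specialized'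
    (W' : WeierstrassCurve ℚ) [W'.IsElliptic] (K : Type) [Field K] [NumberField K]
    (κ : ZpExtension K 3) (γ : Field.absoluteGaloisGroup K) [hγ : Fact (κ.IsTopGenerator γ)]
    (D : (W'.baseChange K).SelmerDualData κ γ) (C : ℕ)
    (hrank : ∀ m₀ : ℕ, ∃ m : ℕ, m₀ ≤ m ∧
      lambdaInvariant 3 (D.X ⧸ (Ideal.span {(PowerSeries.X ^ m + PowerSeries.C ((3 : ℕ) : ℤ_[3]) : IwasawaAlgebra 3)} •
        (⊤ : Submodule (IwasawaAlgebra 3) D.X))) ≤ m + C)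
    {S : Type*} [AddCommGroup S] [Module (IwasawaAlgebra 3) S] [Module.Finite (IwasawaAlgebra 3) S]
    [NoZeroSMulDivisors (IwasawaAlgebra 3) S]
    (hS1 : Module.finrank (IwasawaAlgebra 3) S = 1) (κ₁ : S)
    (loc : S →ₗ[IwasawaAlgebra 3] IwasawaAlgebra 3) (hβ : loc κ₁ ∉ augIdealP 3)
    (hKS : ∃ C m₀ : ℕ, ∀ m : ℕ, m₀ ≤ m →
      Nat.card (↥(Submodule.torsion (IwasawaAlgebra 3) D.X) ⧸
        (Ideal.span {(PowerSeries.X ^ m + PowerSeries.C ((3 : ℕ) : ℤ_[3]) : IwasawaAlgebra 3)} • ⊤ :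
          Submodule (IwasawaAlgebra 3) ↥(Submodule.torsion (IwasawaAlgebra 3) D.X))) ≤
      3 ^ C * Nat.card ((S ⧸ Submodule.span (IwasawaAlgebra 3) {κ₁}) ⧸
        (Ideal.span {(PowerSeries.X ^ m + PowerSeries.C ((3 : ℕ) : ℤ_[3]) : IwasawaAlgebra 3)} • ⊤ :
          Submodule (IwasawaAlgebra 3) (S ⧸ Submodule.span (IwasawaAlgebra 3) {κ₁}))) ^ 2) :
    Module.rank (IwasawaAlgebra 3) D.X ≤ 1 ∧
      muInvariant 3 ↥(Submodule.torsion (IwasawaAlgebra 3) D.X) = 0 := by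
  haveI : (W'.baseChange K).IsElliptic := by rw [WeierstrassCurve.baseChange]; infer_instance
  haveI : Module.Finite (IwasawaAlgebra 3) D.X := D.module_finite_holds hγ.out
  exact rank_le_one_and_muInvariant_torsion_eq_zero_of_specialized (p := 3) C hrank hS1 κ₁ loc hβ hKS

/-- **The CONCLUSION of the v8 stub `stub_selmerDualRankLeOneMuZeroOfBeta` VERBATIM** — for the CANONICAL dual datum
`(W′.baseChange K).selmerDualData κ hγ.out` — from the specialised outputs `hrank ∧ hKS ∧ (loc κ₁ ∉ 3Λ)` at Howard's primes `q_m = T^m + 3`.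
So the port of K2_struct∣β along the Eisenstein road is reduced, in the kernel, to producing `hrank` (Thm. 1.6.1 (i)–(ii) + control) and `hKS`
(Thm. 1.6.1 (iii) + control) for `X = X(E′/K_∞)` and `𝔖 ∋ κ₁` with `loc_𝔭 κ₁ ∉ 3Λ` (E6, from K1). [cite: Howard2004HeegnerKolyvagin, Thm. 1.6.1, Thm. B] -/
theorem selmerDualRankLeOneMuZero_of_specialized
    (W' : WeierstrassCurve ℚ) [W'.IsElliptic] (K : Type) [Field K] [NumberField K]
    (κ : ZpExtension K 3) (γ : Field.absoluteGaloisGroup K) [hγ : Fact (κ.IsTopGenerator γ)] (C : ℕ)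
    (hrank : ∀ m₀ : ℕ, ∃ m : ℕ, m₀ ≤ m ∧
      lambdaInvariant 3 (((W'.baseChange K).selmerDualData κ hγ.out).X ⧸
        (Ideal.span {(PowerSeries.X ^ m + PowerSeries.C ((3 : ℕ) : ℤ_[3]) : IwasawaAlgebra 3)} •
          (⊤ : Submodule (IwasawaAlgebra 3) ((W'.baseChange K).selmerDualData κ hγ.out).X))) ≤ m + C)
    {S : Type*} [AddCommGroup S] [Module (IwasawaAlgebra 3) S] [Module.Finite (IwasawaAlgebra 3) S]
    [NoZeroSMulDivisors (IwasawaAlgebra 3) S]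
    (hS1 : Module.finrank (IwasawaAlgebra 3) S = 1) (κ₁ : S)
    (loc : S →ₗ[IwasawaAlgebra 3] IwasawaAlgebra 3) (hβ : loc κ₁ ∉ augIdealP 3)
    (hKS : ∃ C m₀ : ℕ, ∀ m : ℕ, m₀ ≤ m →
      Nat.card (↥(Submodule.torsion (IwasawaAlgebra 3) ((W'.baseChange K).selmerDualData κ hγ.out).X) ⧸
        (Ideal.span {(PowerSeries.X ^ m + PowerSeries.C ((3 : ℕ) : ℤ_[3]) : IwasawaAlgebra 3)} • ⊤ :
          Submodule (IwasawaAlgebra 3) ↥(Submodule.torsion (IwasawaAlgebra 3) ((W'.baseChange K).selmerDualData κ hγ.out).X))) ≤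
      3 ^ C * Nat.card ((S ⧸ Submodule.span (IwasawaAlgebra 3) {κ₁}) ⧸
        (Ideal.span {(PowerSeries.X ^ m + PowerSeries.C ((3 : ℕ) : ℤ_[3]) : IwasawaAlgebra 3)} • ⊤ :
          Submodule (IwasawaAlgebra 3) (S ⧸ Submodule.span (IwasawaAlgebra 3) {κ₁}))) ^ 2) :
    Module.rank (IwasawaAlgebra 3) ((W'.baseChange K).selmerDualData κ hγ.out).X ≤ 1 ∧
      muInvariant 3 ↥(Submodule.torsion (IwasawaAlgebra 3) ((W'.baseChange K).selmerDualData κ hγ.out).X) = 0 :=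
  selmerDualRankLeOneMuZero_of_specialized' W' K κ γ ((W'.baseChange K).selmerDualData κ hγ.out) C hrank hS1 κ₁ loc hβ hKS

end K2Struct

/-! ## §3 The same in cell `bsd-print-x9`'s WITNESS currency `HasSpecWitnesses` -/

section Witness

open WeierstrassCurve Summit.BirchSwinnertonDyer.BirchSwinnertonDyer.Theorems.HeegnerMuPartStabilized
  Summit.BirchSwinnertonDyer.BirchSwinnertonDyer.Theorems.UniversalToricDescentTwoSidedMuTransfer

variable {p : ℕ} [Fact p.Prime]

/-- **`hrank ∧ HasSpecWitnesses ∧ loc κ₁ ∉ pΛ ⟹ rank ≤ 1 ∧ μ(X_tors) = 0`** (pure algebra, any `p`). `X` finitely generated over `Λ`;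
`hrank`: `rank_{ℤ_p} X/q_m X ≤ m + C` for infinitely many `m`; `𝔖` finitely generated torsion-free of `Λ`-rank one, `κ₁ ∈ 𝔖`,
`loc : 𝔖 →ₗ Λ`, `loc κ₁ ∉ pΛ`; and `HasSpecWitnesses p 𝔖 X (Λ∙κ₁)` — for all large `m` a `SpecWitness` at `q_m = T^m + p` with a control
constant uniform in `m` (cell x9's interface; its `exists_card_bound_of_specWitnesses` turns the witnesses into the specialised index
inequality `#(X_tors ⧸ q_m) ≤ p^{c}·#((𝔖/Λκ₁) ⧸ q_m)²`). [cite: Howard2004HeegnerKolyvagin, Thm. 1.6.1, proof of Thm. 2.2.10]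
[cite: MastellaZerman2026, Thm. 2.40] -/
theorem rank_le_one_and_muInvariant_torsion_eq_zero_of_hasSpecWitnesses
    {M : Type} [AddCommGroup M] [Module (IwasawaAlgebra p) M] [Module.Finite (IwasawaAlgebra p) M] (C : ℕ)
    (hrank : ∀ m₀ : ℕ, ∃ m : ℕ, m₀ ≤ m ∧
      lambdaInvariant p (M ⧸ (Ideal.span {(PowerSeries.X ^ m + PowerSeries.C (p : ℤ_[p]) : IwasawaAlgebra p)} •
        (⊤ : Submodule (IwasawaAlgebra p) M))) ≤ m + C)
    {S : Type} [AddCommGroup S] [Module (IwasawaAlgebra p) S] [Module.Finite (IwasawaAlgebra p) S]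
    [NoZeroSMulDivisors (IwasawaAlgebra p) S]
    (hS1 : Module.finrank (IwasawaAlgebra p) S = 1) (κ₁ : S)
    (loc : S →ₗ[IwasawaAlgebra p] IwasawaAlgebra p) (hβ : loc κ₁ ∉ augIdealP p)
    (hW : HasSpecWitnesses p S M (Submodule.span (IwasawaAlgebra p) {κ₁})) :
    Module.rank (IwasawaAlgebra p) M ≤ 1 ∧ muInvariant p ↥(Submodule.torsion (IwasawaAlgebra p) M) = 0 := by
  have hloc0 : loc κ₁ ≠ 0 := fun h => hβ (h ▸ Submodule.zero_mem _)
  have hκ0 : κ₁ ≠ 0 := fun h => hloc0 (by rw [h, map_zero])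
  have hL : Module.IsTorsion (IwasawaAlgebra p) (S ⧸ Submodule.span (IwasawaAlgebra p) {κ₁}) :=
    isTorsion_quotient_span_of_finrank_eq_one hS1 hκ0
  obtain ⟨c, m₀, hKS⟩ := exists_card_bound_of_specWitnesses p (Submodule.span (IwasawaAlgebra p) {κ₁}) hL hW
  exact rank_le_one_and_muInvariant_torsion_eq_zero_of_specialized C hrank hS1 κ₁ loc hβ ⟨c, m₀, hKS⟩

/-- **The CONCLUSION of `stub_selmerDualRankLeOneMuZeroOfBeta` VERBATIM from `hrank ∧ HasSpecWitnesses ∧ loc κ₁ ∉ 3Λ`** (canonical dual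
datum `(W′.baseChange K).selmerDualData κ hγ.out`; `q_m = T^m + 3`). So the Eisenstein-road port of K2_struct∣β is: x9's `SpecWitness`es for
`(𝔖, X(E′/K_∞), Λ∙κ₁)` at all large `q_m` (from Thm. 1.6.1's CONCLUSION on the Tate-line `DVRSetting` over `S_m` + the control readout —
the x9/x10b turnkeys), the rank readout `hrank`, and E6 `loc_𝔭 κ₁ ∉ 3Λ` from K1. [cite: Howard2004HeegnerKolyvagin, Thm. 1.6.1, Thm. B]
[cite: MastellaZerman2026, Thm. 2.40] -/
theorem selmerDualRankLeOneMuZero_of_hasSpecWitnesses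
    (W' : WeierstrassCurve ℚ) [W'.IsElliptic] (K : Type) [Field K] [NumberField K]
    (κ : ZpExtension K 3) (γ : Field.absoluteGaloisGroup K) [hγ : Fact (κ.IsTopGenerator γ)] (C : ℕ)
    (hrank : ∀ m₀ : ℕ, ∃ m : ℕ, m₀ ≤ m ∧
      lambdaInvariant 3 (((W'.baseChange K).selmerDualData κ hγ.out).X ⧸
        (Ideal.span {(PowerSeries.X ^ m + PowerSeries.C ((3 : ℕ) : ℤ_[3]) : IwasawaAlgebra 3)} •
          (⊤ : Submodule (IwasawaAlgebra 3) ((W'.baseChange K).selmerDualData κ hγ.out).X))) ≤ m + C)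
    {S : Type} [AddCommGroup S] [Module (IwasawaAlgebra 3) S] [Module.Finite (IwasawaAlgebra 3) S]
    [NoZeroSMulDivisors (IwasawaAlgebra 3) S]
    (hS1 : Module.finrank (IwasawaAlgebra 3) S = 1) (κ₁ : S)
    (loc : S →ₗ[IwasawaAlgebra 3] IwasawaAlgebra 3) (hβ : loc κ₁ ∉ augIdealP 3)
    (hW : HasSpecWitnesses 3 S ((W'.baseChange K).selmerDualData κ hγ.out).X (Submodule.span (IwasawaAlgebra 3) {κ₁})) :
    Module.rank (IwasawaAlgebra 3) ((W'.baseChange K).selmerDualData κ hγ.out).X ≤ 1 ∧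
      muInvariant 3 ↥(Submodule.torsion (IwasawaAlgebra 3) ((W'.baseChange K).selmerDualData κ hγ.out).X) = 0 := by
  haveI : (W'.baseChange K).IsElliptic := by rw [WeierstrassCurve.baseChange]; infer_instance
  haveI : Module.Finite (IwasawaAlgebra 3) ((W'.baseChange K).selmerDualData κ hγ.out).X :=
    ((W'.baseChange K).selmerDualData κ hγ.out).module_finite_holds hγ.out
  exact rank_le_one_and_muInvariant_torsion_eq_zero_of_hasSpecWitnesses (p := 3) C hrank hS1 κ₁ loc hβ hW

end Witness

/-! ## §4 (appended) The FUNCTIONAL-FREE E6 form: `𝔖 ≅ Λ` (Howard Thm. B (i)) and `κ₁ ∉ p·𝔖` (lead g23 `…HeegnerClassNotDivisible`)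

`(loc, loc κ₁ ∉ pΛ)` of §1–§3 replaced by `e : 𝔖 ≃ₗ Λ` and `κ₁ ∉ p·𝔖` (g21's `isTorsion_and_muInvariant_eq_zero_of_not_mem_smul`): the three
NAMED OUTPUTS of the lead's v9 plan («𝔖 ≅ Λ» + K1's `κ₁ ∉ 3·𝔖`, «`rank_{ℤ₃} X/q_m X ≤ m + C` infinitely often», «`hKS`» / `HasSpecWitnesses`)
give the conclusion of `stub_selmerDualRankLeOneMuZeroOfBeta` by ONE call. -/

section Free

open WeierstrassCurve Summit.BirchSwinnertonDyer.BirchSwinnertonDyer.Theorems.HeegnerMuPartStabilized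
  Summit.BirchSwinnertonDyer.BirchSwinnertonDyer.Theorems.UniversalToricDescentTwoSidedMuTransfer

variable {p : ℕ} [Fact p.Prime]

/-- **`hrank ∧ hKS ∧ (𝔖 ≅ Λ, κ₁ ∉ p·𝔖) ⟹ rank ≤ 1 ∧ μ(X_tors) = 0`** (pure algebra, any `p`; functional-free E6): with `e : 𝔖 ≃ₗ Λ`
(Howard Thm. B (i): `𝔖` free of rank one) and `κ₁ ∉ p·𝔖` (K1 ⟹ this by the lead's `not_exists_eq_natCast_smul_of_layerIndivisible`),
`𝔖/Λκ₁` is torsion with `μ = 0` (g21's `isTorsion_and_muInvariant_eq_zero_of_not_mem_smul`), so `hKS` gives `μ(X_tors) = 0` and `hrank` gives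
`rank ≤ 1`. [cite: Howard2004HeegnerKolyvagin, Thm. B, proof of Thm. 2.2.10] [cite: GreenbergVatsal2000, p. 2, (1)–(2)] -/
theorem rank_le_one_and_muInvariant_torsion_eq_zero_of_not_mem_smul
    {M : Type*} [AddCommGroup M] [Module (IwasawaAlgebra p) M] [Module.Finite (IwasawaAlgebra p) M] (C : ℕ)
    (hrank : ∀ m₀ : ℕ, ∃ m : ℕ, m₀ ≤ m ∧
      lambdaInvariant p (M ⧸ (Ideal.span {(PowerSeries.X ^ m + PowerSeries.C (p : ℤ_[p]) : IwasawaAlgebra p)} •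
        (⊤ : Submodule (IwasawaAlgebra p) M))) ≤ m + C)
    {S : Type*} [AddCommGroup S] [Module (IwasawaAlgebra p) S] [Module.Finite (IwasawaAlgebra p) S]
    (e : S ≃ₗ[IwasawaAlgebra p] IwasawaAlgebra p) (κ₁ : S) (hz : ¬ ∃ v : S, κ₁ = (p : IwasawaAlgebra p) • v)
    (hKS : ∃ C m₀ : ℕ, ∀ m : ℕ, m₀ ≤ m →
      Nat.card (↥(Submodule.torsion (IwasawaAlgebra p) M) ⧸
        (Ideal.span {(PowerSeries.X ^ m + PowerSeries.C (p : ℤ_[p]) : IwasawaAlgebra p)} • ⊤ :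
          Submodule (IwasawaAlgebra p) ↥(Submodule.torsion (IwasawaAlgebra p) M))) ≤
      p ^ C * Nat.card ((S ⧸ Submodule.span (IwasawaAlgebra p) {κ₁}) ⧸
        (Ideal.span {(PowerSeries.X ^ m + PowerSeries.C (p : ℤ_[p]) : IwasawaAlgebra p)} • ⊤ :
          Submodule (IwasawaAlgebra p) (S ⧸ Submodule.span (IwasawaAlgebra p) {κ₁}))) ^ 2) :
    Module.rank (IwasawaAlgebra p) M ≤ 1 ∧ muInvariant p ↥(Submodule.torsion (IwasawaAlgebra p) M) = 0 := by
  obtain ⟨hT, hμ'⟩ := isTorsion_and_muInvariant_eq_zero_of_not_mem_smul e κ₁ hz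
  exact rank_le_one_and_muInvariant_torsion_eq_zero_of_specialized_of_mu C hrank hT hμ' hKS

/-- **The same with x9's `HasSpecWitnesses p 𝔖 X (Λ∙κ₁)` in place of `hKS`** (`𝔖, X : Type`). [cite: Howard2004HeegnerKolyvagin, Thm. B]
[cite: MastellaZerman2026, Thm. 2.40] -/
theorem rank_le_one_and_muInvariant_torsion_eq_zero_of_not_mem_smul_of_hasSpecWitnesses
    {M : Type} [AddCommGroup M] [Module (IwasawaAlgebra p) M] [Module.Finite (IwasawaAlgebra p) M] (C : ℕ)
    (hrank : ∀ m₀ : ℕ, ∃ m : ℕ, m₀ ≤ m ∧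
      lambdaInvariant p (M ⧸ (Ideal.span {(PowerSeries.X ^ m + PowerSeries.C (p : ℤ_[p]) : IwasawaAlgebra p)} •
        (⊤ : Submodule (IwasawaAlgebra p) M))) ≤ m + C)
    {S : Type} [AddCommGroup S] [Module (IwasawaAlgebra p) S] [Module.Finite (IwasawaAlgebra p) S]
    (e : S ≃ₗ[IwasawaAlgebra p] IwasawaAlgebra p) (κ₁ : S) (hz : ¬ ∃ v : S, κ₁ = (p : IwasawaAlgebra p) • v)
    (hW : HasSpecWitnesses p S M (Submodule.span (IwasawaAlgebra p) {κ₁})) :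
    Module.rank (IwasawaAlgebra p) M ≤ 1 ∧ muInvariant p ↥(Submodule.torsion (IwasawaAlgebra p) M) = 0 := by
  obtain ⟨hT, hμ'⟩ := isTorsion_and_muInvariant_eq_zero_of_not_mem_smul e κ₁ hz
  obtain ⟨c, m₀, hKS⟩ := exists_card_bound_of_specWitnesses p (Submodule.span (IwasawaAlgebra p) {κ₁}) hT hW
  exact rank_le_one_and_muInvariant_torsion_eq_zero_of_specialized_of_mu C hrank hT hμ' ⟨c, m₀, hKS⟩

/-- **The CONCLUSION of `stub_selmerDualRankLeOneMuZeroOfBeta` VERBATIM from the three NAMED OUTPUTS of the port** (lead g23's v9 plan):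
«`𝔖 ≅ Λ`» (`e`, Howard Thm. B (i)) with the `Λ`-adic class `κ₁ ∉ 3·𝔖` (K1 via `…HeegnerClassNotDivisible`), «`rank_{ℤ₃} X/q_m X ≤ m + C`
infinitely often» (`hrank`), and «`hKS`» at `q_m = T^m + 3` for `X = ((W′.baseChange K).selmerDualData κ hγ.out).X`.
[cite: Howard2004HeegnerKolyvagin, Thm. 1.6.1, Thm. B] -/
theorem selmerDualRankLeOneMuZero_of_not_mem_smul
    (W' : WeierstrassCurve ℚ) [W'.IsElliptic] (K : Type) [Field K] [NumberField K]
    (κ : ZpExtension K 3) (γ : Field.absoluteGaloisGroup K) [hγ : Fact (κ.IsTopGenerator γ)] (C : ℕ)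
    (hrank : ∀ m₀ : ℕ, ∃ m : ℕ, m₀ ≤ m ∧
      lambdaInvariant 3 (((W'.baseChange K).selmerDualData κ hγ.out).X ⧸
        (Ideal.span {(PowerSeries.X ^ m + PowerSeries.C ((3 : ℕ) : ℤ_[3]) : IwasawaAlgebra 3)} •
          (⊤ : Submodule (IwasawaAlgebra 3) ((W'.baseChange K).selmerDualData κ hγ.out).X))) ≤ m + C)
    {S : Type*} [AddCommGroup S] [Module (IwasawaAlgebra 3) S] [Module.Finite (IwasawaAlgebra 3) S]
    (e : S ≃ₗ[IwasawaAlgebra 3] IwasawaAlgebra 3) (κ₁ : S) (hz : ¬ ∃ v : S, κ₁ = ((3 : ℕ) : IwasawaAlgebra 3) • v)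
    (hKS : ∃ C m₀ : ℕ, ∀ m : ℕ, m₀ ≤ m →
      Nat.card (↥(Submodule.torsion (IwasawaAlgebra 3) ((W'.baseChange K).selmerDualData κ hγ.out).X) ⧸
        (Ideal.span {(PowerSeries.X ^ m + PowerSeries.C ((3 : ℕ) : ℤ_[3]) : IwasawaAlgebra 3)} • ⊤ :
          Submodule (IwasawaAlgebra 3) ↥(Submodule.torsion (IwasawaAlgebra 3) ((W'.baseChange K).selmerDualData κ hγ.out).X))) ≤
      3 ^ C * Nat.card ((S ⧸ Submodule.span (IwasawaAlgebra 3) {κ₁}) ⧸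
        (Ideal.span {(PowerSeries.X ^ m + PowerSeries.C ((3 : ℕ) : ℤ_[3]) : IwasawaAlgebra 3)} • ⊤ :
          Submodule (IwasawaAlgebra 3) (S ⧸ Submodule.span (IwasawaAlgebra 3) {κ₁}))) ^ 2) :
    Module.rank (IwasawaAlgebra 3) ((W'.baseChange K).selmerDualData κ hγ.out).X ≤ 1 ∧
      muInvariant 3 ↥(Submodule.torsion (IwasawaAlgebra 3) ((W'.baseChange K).selmerDualData κ hγ.out).X) = 0 := by
  haveI : (W'.baseChange K).IsElliptic := by rw [WeierstrassCurve.baseChange]; infer_instance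
  haveI : Module.Finite (IwasawaAlgebra 3) ((W'.baseChange K).selmerDualData κ hγ.out).X :=
    ((W'.baseChange K).selmerDualData κ hγ.out).module_finite_holds hγ.out
  exact rank_le_one_and_muInvariant_torsion_eq_zero_of_not_mem_smul (p := 3) C hrank e κ₁ hz hKS

/-- **The same with `HasSpecWitnesses 3 𝔖 X (Λ∙κ₁)` in place of `hKS`.** [cite: Howard2004HeegnerKolyvagin, Thm. B] [cite: MastellaZerman2026, Thm. 2.40] -/
theorem selmerDualRankLeOneMuZero_of_not_mem_smul_of_hasSpecWitnesses
    (W' : WeierstrassCurve ℚ) [W'.IsElliptic] (K : Type) [Field K] [NumberField K]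
    (κ : ZpExtension K 3) (γ : Field.absoluteGaloisGroup K) [hγ : Fact (κ.IsTopGenerator γ)] (C : ℕ)
    (hrank : ∀ m₀ : ℕ, ∃ m : ℕ, m₀ ≤ m ∧
      lambdaInvariant 3 (((W'.baseChange K).selmerDualData κ hγ.out).X ⧸
        (Ideal.span {(PowerSeries.X ^ m + PowerSeries.C ((3 : ℕ) : ℤ_[3]) : IwasawaAlgebra 3)} •
          (⊤ : Submodule (IwasawaAlgebra 3) ((W'.baseChange K).selmerDualData κ hγ.out).X))) ≤ m + C)
    {S : Type} [AddCommGroup S] [Module (IwasawaAlgebra 3) S] [Module.Finite (IwasawaAlgebra 3) S]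
    (e : S ≃ₗ[IwasawaAlgebra 3] IwasawaAlgebra 3) (κ₁ : S) (hz : ¬ ∃ v : S, κ₁ = ((3 : ℕ) : IwasawaAlgebra 3) • v)
    (hW : HasSpecWitnesses 3 S ((W'.baseChange K).selmerDualData κ hγ.out).X (Submodule.span (IwasawaAlgebra 3) {κ₁})) :
    Module.rank (IwasawaAlgebra 3) ((W'.baseChange K).selmerDualData κ hγ.out).X ≤ 1 ∧
      muInvariant 3 ↥(Submodule.torsion (IwasawaAlgebra 3) ((W'.baseChange K).selmerDualData κ hγ.out).X) = 0 := by
  haveI : (W'.baseChange K).IsElliptic := by rw [WeierstrassCurve.baseChange]; infer_instance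
  haveI : Module.Finite (IwasawaAlgebra 3) ((W'.baseChange K).selmerDualData κ hγ.out).X :=
    ((W'.baseChange K).selmerDualData κ hγ.out).module_finite_holds hγ.out
  exact rank_le_one_and_muInvariant_torsion_eq_zero_of_not_mem_smul_of_hasSpecWitnesses (p := 3) C hrank e κ₁ hz hW

end Free

end Summit.BirchSwinnertonDyer.BirchSwinnertonDyer.Theorems.UniversalToricDescentK2StructOfSpecialized

end
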